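import Literature.AlgebraicGeometry.Motives.SeesawSubschemeReprIdeal
import HarnessLib

/-!
# The seesaw closed subscheme, global half: the glued ideal sheaf and the universal property for every test scheme

[MumfordAV1970] §10 (p. 89) / [GortzWedhorn2023] Thm. 24.66, the GLOBAL half of the scheme-theoretic seesaw theorem
for a rank-one quasi-coherent module `𝓕` on `X × W` (`X/ℂ` proper and geometrically integral with a point `x₀`, `W/ℂ`
locally of finite type), from the two named statements of `SeesawSubschemeReprIdeal`:
* §1 `reprIdealSheaf` — given `N1cLocal` (a representing ideal on every affine open), the affine-local representing
  ideals are compatible with basic opens by uniqueness, hence glue to a `Scheme.IdealSheafData` on `W` (no scheme gluing);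
* §2 `seesawSubscheme` = its closed subscheme `Z(𝓕) ↪ W`; `factors_iff_le_ker` (Mathlib `IsClosedImmersion.lift`):
  `u : S → W` factors through `Z(𝓕)` iff the ideal sheaf dies under `u`; `le_ker_iff_trivFromBase`: for an ARBITRARY
  test scheme `S/ℂ` this happens iff `(1 × u)^*𝓕` is trivialised from the base — cover `S` by affine opens mapping into
  affine opens of `W`, use the representing property there, and glue by `N1cDelta`;
* HEAD `exists_seesawSubscheme_of_sockets (hloc : N1cLocal) (hδ : N1cDelta) … : ∃ Z i, IsClosedImmersion i.left ∧
  ∀ S (u : S ⟶ W), (∃ v, v ≫ i = u) ↔ TrivFromBase`.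
(Cell `hodgecm-mathlib`, M13 node N1, file S2 of the split plan; HOME certificate `B-plan/m13-glue/N1-Assembly.v9.B-p01g12.lean`
164baf9abb46c288, decls token-identical.)

## References
* [MumfordAV1970] D. Mumford, *Abelian Varieties* (1970), §10 p. 89.
* [GortzWedhorn2023] U. Görtz, T. Wedhorn, *Algebraic Geometry II* (2023), Thm. 24.66 (p. 405; proof pp. 407–408).
-/

set_option autoImplicit false

noncomputable section

universe u

open CategoryTheory CategoryTheory.Limits AlgebraicGeometry MonoidalCategory CartesianMonoidalCategory

namespace Literature.AlgebraicGeometry.Motives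

open SeesawSubscheme

/-! ## §1 The ideal sheaf glued from the affine-local representing ideals -/

namespace SeesawSubscheme

variable (X : SchemeOver ℂ) [IsProper X.hom] [GeometricallyIntegral X.hom] (x₀ : 𝟙_ (SchemeOver ℂ) ⟶ X)
  (W : SchemeOver ℂ) [LocallyOfFiniteType W.hom] (𝓕 : (X ⊗ W).left.Modules) [𝓕.IsQuasicoherent]
  (h𝓕 : HasRank 𝓕 1)

/-- The representing ideal on an affine open, chosen from the hypothesis `N1cLocal` (non-Prop plumbing).
[cite: MumfordAV1970, §10 (p. 89)] -/
def reprIdeal (hloc : N1cLocal) (U : W.left.affineOpens) : Ideal Γ(W.left, U) :=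
  (hloc X x₀ W 𝓕 h𝓕 U).choose

/-- The chosen ideal represents. [cite: MumfordAV1970, §10 (p. 89)] -/
theorem isReprIdeal_reprIdeal (hloc : N1cLocal) (U : W.left.affineOpens) :
    IsReprIdeal X 𝓕 U (reprIdeal X x₀ W 𝓕 h𝓕 hloc U) :=
  (hloc X x₀ W 𝓕 h𝓕 U).choose_spec

/-- **The seesaw ideal sheaf** of `𝓕` on `W`: the affine-local representing ideals are compatible with
basic opens by uniqueness, hence form an `IdealSheafData` (non-Prop plumbing).
[cite: MumfordAV1970, §10 (p. 89)] [cite: GortzWedhorn2023, Thm. 24.66 (p. 405; proof pp. 407–408)] -/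
def reprIdealSheaf (hloc : N1cLocal) : W.left.IdealSheafData where
  ideal U := reprIdeal X x₀ W 𝓕 h𝓕 hloc U
  map_ideal_basicOpen U f :=
    ((isReprIdeal_reprIdeal X x₀ W 𝓕 h𝓕 hloc U).map_basicOpen X 𝓕 f).unique X 𝓕
      (isReprIdeal_reprIdeal X x₀ W 𝓕 h𝓕 hloc (W.left.affineBasicOpen f))

/-- The glued ideal sheaf has the chosen representing ideals as sections. [cite: MumfordAV1970, §10 (p. 89)] -/
@[simp]
theorem reprIdealSheaf_ideal (hloc : N1cLocal) (U : W.left.affineOpens) :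
    (reprIdealSheaf X x₀ W 𝓕 h𝓕 hloc).ideal U = reprIdeal X x₀ W 𝓕 h𝓕 hloc U := rfl

end SeesawSubscheme

/-! ## §2 The seesaw closed subscheme and its universal property -/

namespace SeesawSubscheme

variable (X : SchemeOver ℂ) [IsProper X.hom] [GeometricallyIntegral X.hom] (x₀ : 𝟙_ (SchemeOver ℂ) ⟶ X)
  (W : SchemeOver ℂ) [LocallyOfFiniteType W.hom] (𝓕 : (X ⊗ W).left.Modules) [𝓕.IsQuasicoherent]
  (h𝓕 : HasRank 𝓕 1)

/-- **The seesaw subscheme** `Z(𝓕) ↪ W`: the closed subscheme of the glued representing ideal sheaf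
(non-Prop plumbing). [cite: MumfordAV1970, §10 (p. 89)] [cite: GortzWedhorn2023, Thm. 24.66 (p. 405; proof pp. 407–408)] -/
def seesawSubscheme (hloc : N1cLocal) : SchemeOver ℂ :=
  Over.mk ((reprIdealSheaf X x₀ W 𝓕 h𝓕 hloc).subschemeι ≫ W.hom)

/-- The closed immersion `Z(𝓕) ↪ W` over `ℂ` (non-Prop plumbing). [cite: MumfordAV1970, §10 (p. 89)] -/
def seesawSubschemeι (hloc : N1cLocal) : seesawSubscheme X x₀ W 𝓕 h𝓕 hloc ⟶ W :=
  Over.homMk (reprIdealSheaf X x₀ W 𝓕 h𝓕 hloc).subschemeι rfl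

/-- Underlying closed immersion of `Z(𝓕) ↪ W`. [cite: MumfordAV1970, §10 (p. 89)] -/
@[simp]
theorem seesawSubschemeι_left (hloc : N1cLocal) :
    (seesawSubschemeι X x₀ W 𝓕 h𝓕 hloc).left = (reprIdealSheaf X x₀ W 𝓕 h𝓕 hloc).subschemeι := rfl

/-- `Z(𝓕) ↪ W` is a closed immersion (instance on the file-local definition). [folklore] -/
instance (hloc : N1cLocal) : IsClosedImmersion (seesawSubschemeι X x₀ W 𝓕 h𝓕 hloc).left :=
  (inferInstance : IsClosedImmersion (reprIdealSheaf X x₀ W 𝓕 h𝓕 hloc).subschemeι)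

/-- The kernel ideal sheaf of `Z(𝓕) ↪ W` is the seesaw ideal sheaf. [cite: MumfordAV1970, §10 (p. 89)] -/
theorem ker_seesawSubschemeι_left (hloc : N1cLocal) :
    (seesawSubschemeι X x₀ W 𝓕 h𝓕 hloc).left.ker = reprIdealSheaf X x₀ W 𝓕 h𝓕 hloc :=
  (reprIdealSheaf X x₀ W 𝓕 h𝓕 hloc).ker_subschemeι

/-- **Factoring through `Z(𝓕)` ⟺ killing its ideal sheaf** (Mathlib `IsClosedImmersion.lift`). [cite: MumfordAV1970, §10 (p. 89)] -/
theorem factors_iff_le_ker (hloc : N1cLocal) {S : SchemeOver ℂ} (u : S ⟶ W) :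
    (∃ v : S ⟶ seesawSubscheme X x₀ W 𝓕 h𝓕 hloc, v ≫ seesawSubschemeι X x₀ W 𝓕 h𝓕 hloc = u) ↔
      reprIdealSheaf X x₀ W 𝓕 h𝓕 hloc ≤ u.left.ker := by
  constructor
  · rintro ⟨v, hv⟩
    rw [← ker_seesawSubschemeι_left X x₀ W 𝓕 h𝓕 hloc, ← hv, Over.comp_left]
    exact Scheme.Hom.le_ker_comp _ _
  · intro hle
    have hle' : (seesawSubschemeι X x₀ W 𝓕 h𝓕 hloc).left.ker ≤ u.left.ker := by
      rwa [ker_seesawSubschemeι_left]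
    refine ⟨Over.homMk (IsClosedImmersion.lift (seesawSubschemeι X x₀ W 𝓕 h𝓕 hloc).left u.left hle')
      ?_, ?_⟩
    · rw [← Over.w (seesawSubschemeι X x₀ W 𝓕 h𝓕 hloc), ← Category.assoc, IsClosedImmersion.lift_fac]
      exact Over.w u
    · ext : 1
      exact IsClosedImmersion.lift_fac _ _ _

/-- **Killing the ideal sheaf ⟺ trivialised from the base**, for an ARBITRARY test scheme `S` over `ℂ`
(sheaf locality on the test scheme + the affine-local representing property on the affine opens of `S` mapping
into affine opens of `W` + the locality statement `N1cDelta`).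
[cite: MumfordAV1970, §10 (p. 89)] -/
theorem le_ker_iff_trivFromBase (hloc : N1cLocal) (hδ : N1cDelta) {S : SchemeOver ℂ} (u : S ⟶ W) :
    reprIdealSheaf X x₀ W 𝓕 h𝓕 hloc ≤ u.left.ker ↔ TrivFromBase X 𝓕 u := by
  have hrepr := isReprIdeal_reprIdeal X x₀ W 𝓕 h𝓕 hloc
  change reprIdealSheaf X x₀ W 𝓕 h𝓕 hloc ≤
    Scheme.IdealSheafData.ofIdeals (fun U => RingHom.ker (u.left.app U).hom) ↔ _
  rw [Scheme.IdealSheafData.le_ofIdeals_iff]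
  constructor
  · -- `⇒`: locally on `S` the test morphism lands in an affine of `W`, where the ideal is killed
    intro hJ
    refine hδ X W 𝓕 h𝓕 S u fun s => ?_
    obtain ⟨U', hU', hsU', -⟩ :=
      exists_isAffineOpen_mem_and_subset (show u.left.base s ∈ (⊤ : W.left.Opens) from trivial)
    obtain ⟨V', hV', hsV', hV'U⟩ :=
      exists_isAffineOpen_mem_and_subset (show s ∈ u.left ⁻¹ᵁ U' from hsU')
    haveI : IsAffine (openTest V').left := hV'
    have htriv : TrivFromBase X 𝓕 (restrictTest V' u) :=
      (hrepr ⟨U', hU'⟩ (openTest V') (restrictTest V' u) (preimage_restrictTest_eq_top hV'U)).2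
        ((hJ ⟨U', hU'⟩).trans (ker_app_le_ker_restrictTest_app V' u U'))
    exact ⟨V', hsV', htriv⟩
  · -- `⇐`: on every affine `V ⊆ u⁻¹U` the restricted test morphism is trivialised, so the ideal dies
    --      there; by sheaf locality it dies in `Γ(S, u⁻¹U)`
    intro htriv U x hx
    refine app_eq_zero_of_forall_affineOpens u U x fun V hV => ?_
    haveI : IsAffine (openTest (V : S.left.Opens)).left := V.2
    exact (hrepr U (openTest (V : S.left.Opens)) (restrictTest (V : S.left.Opens) u)
      (preimage_restrictTest_eq_top hV)).1 (htriv.restrict X 𝓕 (V : S.left.Opens)) hx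

/-- **N1, GLOBAL HALF — the universal property of the seesaw subscheme for every test scheme `S/ℂ`**,
from the statements `N1cLocal` (affine-local representing ideals) and `N1cDelta` (locality of
«trivialised from the base» on the test scheme). [cite: MumfordAV1970, §10 (p. 89)]
[cite: GortzWedhorn2023, Thm. 24.66 (p. 405; proof pp. 407–408)] -/
theorem seesawSubscheme_universal (hloc : N1cLocal) (hδ : N1cDelta) {S : SchemeOver ℂ} (u : S ⟶ W) :
    (∃ v : S ⟶ seesawSubscheme X x₀ W 𝓕 h𝓕 hloc, v ≫ seesawSubschemeι X x₀ W 𝓕 h𝓕 hloc = u) ↔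
      TrivFromBase X 𝓕 u :=
  (factors_iff_le_ker X x₀ W 𝓕 h𝓕 hloc u).trans (le_ker_iff_trivFromBase X x₀ W 𝓕 h𝓕 hloc hδ u)

end SeesawSubscheme

/-- **N1 `stub_M13_1_seesawSubscheme` (B-p12 probe :191/:205, ALL test schemes `S/ℂ`),
FROM THE STATEMENTS `N1cLocal` + `N1cDelta`**: for a proper geometrically integral `X/ℂ` with a rational
point, a locally-finite-type `W` and a rank-one quasi-coherent `𝓕` on `X × W`, there is a closed subscheme
`Z ↪ W` such that ANY `u : S → W` over `ℂ` factors through `Z` iff `(1 × u)^*𝓕 ≅ pr_S^*𝓜` for an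
invertible quasi-coherent `𝓜` on `S`. [cite: MumfordAV1970, §10 (p. 89)] [cite: GortzWedhorn2023, Thm. 24.66 (p. 405; proof pp. 407–408)] -/
theorem exists_seesawSubscheme_of_sockets (hloc : N1cLocal) (hδ : N1cDelta)
    (X : SchemeOver ℂ) [IsProper X.hom] [GeometricallyIntegral X.hom] (x₀ : 𝟙_ (SchemeOver ℂ) ⟶ X)
    (W : SchemeOver ℂ) [LocallyOfFiniteType W.hom] (𝓕 : (X ⊗ W).left.Modules) [𝓕.IsQuasicoherent]
    (h𝓕 : HasRank 𝓕 1) :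
    ∃ (Z : SchemeOver ℂ) (i : Z ⟶ W) (_ : IsClosedImmersion i.left),
      ∀ (S : SchemeOver ℂ) (u : S ⟶ W),
        (∃ v : S ⟶ Z, v ≫ i = u) ↔
          ∃ (𝓜 : S.left.Modules) (_ : 𝓜.IsQuasicoherent) (_ : HasRank 𝓜 1),
            Nonempty ((Scheme.Modules.pullback (X ◁ u).left).obj 𝓕 ≅
              (Scheme.Modules.pullback (CartesianMonoidalCategory.snd X S).left).obj 𝓜) :=
  ⟨seesawSubscheme X x₀ W 𝓕 h𝓕 hloc, seesawSubschemeι X x₀ W 𝓕 h𝓕 hloc, inferInstance,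
    fun _ u => seesawSubscheme_universal X x₀ W 𝓕 h𝓕 hloc hδ u⟩

end Literature.AlgebraicGeometry.Motives

end
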